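import Summits.HodgeConjecture.HodgeConjecture.Theorems.K2LiuUnipotentChart                  -- ★ p06: the chart `X ↦ n(X)`
import Summits.HodgeConjecture.HodgeConjecture.Theorems.K2LiuSiegelDoubledRationalPoints      -- ★ p09: `gramRL_facts`, `map_cstar`, …
import Literature.NumberTheory.Automorphic.AdeleRingTopology                                  -- ★ `𝔸_L = L + C`
import Literature.NumberTheory.Automorphic.AdicCompletionCompact                              -- ★ `𝒪_v` compact
import Literature.NumberTheory.Automorphic.UnitaryGroupOfFormAdelicTopology                   -- ★ `continuous_conjAdele`
import HarnessLib

/-!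
# `N_Δ(L⁺)\N_Δ(𝔸)` is compact: the binder (C0) of O41.3 ∕ O41.4 ∕ E5′c (organ E5′c, first half)

Track B ∕ hLiu418 = stmt-HodgeConjecture-24832, line `K2_Liu_CurveThetaSigs`, socket #41, organ O41.3 (seat `hodgecm-mathlib-K2Liu-p06` (g0),
LEAD F0P6-plan deal 2026-09-03T23:05:23Z; (C0) taken 23:35Z under interim rule R3).  FILE 2 of (C0).

**`exists_isCompact_cover_unipDelta`** — for a non-degenerate doubled datum there is a COMPACT `K ⊆ N_Δ(𝔸)` meeting every `N_Δ(L⁺)`-orbit: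
`∀ u ∈ N_Δ(𝔸), ∃ γ ∈ N_Δ(L⁺), γ · u ∈ K`, i.e. `N_Δ(L⁺)\N_Δ(𝔸)` is compact («as `U'(k)\U'(𝔸)` is compact», [MoeglinWaldspurger1995, II.1.6]).
This is the hypothesis `hcover` of ★ `K2LiuUnipotentCoveringWeight.exists_isCoveringWeight_unipDeltaRat_of_cover` (p855540), of
★ `K2LiuSiegelEisensteinMajorantLocallyBounded.exists_weight_lintegral_majorant_ne_top` (p855574) and of
★ `K2LiuIntertwiningConvergesOfParabolic.integrable_weylDelta_mul_of_parabolic_of_cover` (p855629).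

Proof.  In the chart `X ↦ n(X)` of ★ `K2LiuUnipotentChart` (`N_Δ(𝔸) = {n(X) : T_𝔸 X + X^* T_𝔸 = 0}`, continuous, additive, rational on
rational `X`): the additive map `P(Y) := Y − T_𝔸⁻¹ Y^* T_𝔸` is continuous, takes values in the skew matrices, satisfies `P(Z) = 2Z` on skew `Z`,
and carries rational matrices to rational matrices (`T_𝔸 = T_L ⊗ 1` is rational, `σ`-fixed, symmetric, invertible — ★ `gramRL_facts`).
By ★ `AdeleRing.exists_isCompact_forall_exists_sub_mem` (`𝔸_L = L + C`, `C` compact) every `X' = ½X` is entrywise `Y' + E` with `Y'` rational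
and `E` in the compact box `C^{n×n}`; then `n(−P(Y')) ∈ N_Δ(L⁺)` and `n(−P(Y')) · n(X) = n(X − P(Y')) = n(P(E))` lies in the compact
`K := n(P(C^{n×n}))`.

Theorems only; axioms ⊆ {propext, Classical.choice, Quot.sound}.

## References
* C. Moeglin, J.-L. Waldspurger, *Spectral decomposition and Eisenstein series* (1995), I.2.1, II.1.6 [MoeglinWaldspurger1995].
* J. W. S. Cassels, A. Fröhlich (eds.), *Algebraic Number Theory* (1967), Ch. II §14 (`k\𝔸_k` compact) [CasselsFrohlichANT1967].

HONEST LABEL: HC_CM is proved only modulo the 7 printed citations (2 remaining named inputs: hLiu418 = stmt-HodgeConjecture-24832,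
h413 = stmt-HodgeConjecture-24833) until rung 0 closes; this helper moves no counter.
-/

set_option autoImplicit false
set_option linter.dupNamespace false

noncomputable section

open scoped Matrix
open NumberField IsDedekindDomain

namespace Summit.HodgeConjecture.HodgeConjecture.Cruxes.HLiu418.K2LiuUnipotentCocompact

open Literature.NumberTheory.Automorphic Literature.NumberTheory.Automorphic.UnitaryGroup Literature.NumberTheory.GaloisRepresentations
open Literature.NumberTheory.Automorphic.DoubledUnitary.RankOneReduction
open Literature.NumberTheory.GelbartRogawski1991 Literature.NumberTheory.GelbartRogawski1991.GRConstruction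
open Literature.NumberTheory.K2Lit.SiegelDoubled
open Summit.HodgeConjecture.HodgeConjecture.Cruxes.HLiu418.K2LiuSiegelDoubledLeviMatrix
open Summit.HodgeConjecture.HodgeConjecture.Cruxes.HLiu418.K2LiuSiegelDoubledRationalPoints
open Summit.HodgeConjecture.HodgeConjecture.Cruxes.HLiu418.K2LiuUnipotentChart

variable (L : Type) [Field L] [NumberField L] [IsCMField L]
variable {N M n : ℕ} (e : Fin N × Fin M ≃ Fin n)
  (dV : Fin N → L) (hdV : ∀ i, IsCMField.complexConj L (dV i) = dV i)
  (dW : Fin M → L) (hdW : ∀ i, IsCMField.complexConj L (dW i) = dW i)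

/-! ## §1 The skew projection `P(Y) = Y − T⁻¹ Y^* T` -/

section Projection

variable {R : Type*} [CommRing R] (σ : R →+* R) {ι : Type*} [Fintype ι] [DecidableEq ι] {T : Matrix ι ι R}

/-- **`P(Y) := Y − T⁻¹ σ(Y)ᵀ T` is `T`-skew** when `T` is invertible, `σ`-fixed and symmetric and `σ` is an involution:
`T P(Y) + σ(P(Y))ᵀ T = (T Y − σ(Y)ᵀ T) + (σ(Y)ᵀ T − T Y) = 0`. [folklore] -/
theorem skew_sub_conj (hT : IsUnit T.det) (hTσ : T.map σ = T) (hTt : Tᵀ = T) (hσ : ∀ x, σ (σ x) = x) (Y : Matrix ι ι R) :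
    T * (Y - T⁻¹ * (Y.map σ)ᵀ * T) + ((Y - T⁻¹ * (Y.map σ)ᵀ * T).map σ)ᵀ * T = 0 := by
  have hTinvσ : T⁻¹.map σ = T⁻¹ := map_nonsing_inv_eq hT hTσ
  have hTinvt : (T⁻¹)ᵀ = T⁻¹ := by rw [Matrix.transpose_nonsing_inv, hTt]
  have hYσσ : ((Y.map σ)ᵀ).map σ = Yᵀ := by rw [← Matrix.transpose_map, map_map_of_involutive hσ]
  have h1 : ((Y - T⁻¹ * (Y.map σ)ᵀ * T).map σ)ᵀ = (Y.map σ)ᵀ - T * Y * T⁻¹ := by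
    rw [Matrix.map_sub _ (map_sub σ), Matrix.map_mul, Matrix.map_mul, hTinvσ, hTσ, hYσσ, Matrix.transpose_sub, Matrix.transpose_mul,
      Matrix.transpose_mul, Matrix.transpose_transpose, hTinvt, hTt, ← Matrix.mul_assoc]
  rw [h1, Matrix.mul_sub, Matrix.sub_mul, ← Matrix.mul_assoc, ← Matrix.mul_assoc, Matrix.mul_nonsing_inv T hT, Matrix.one_mul,
    Matrix.mul_assoc (T * Y), Matrix.nonsing_inv_mul T hT, Matrix.mul_one]
  abel

/-- `P(Z) = Z + Z` for a `T`-skew `Z` (`σ(Z)ᵀ T = −T Z`). [folklore] -/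
theorem sub_conj_of_skew (hT : IsUnit T.det) {Z : Matrix ι ι R} (hZ : T * Z + (Z.map σ)ᵀ * T = 0) :
    Z - T⁻¹ * (Z.map σ)ᵀ * T = Z + Z := by
  have h : (Z.map σ)ᵀ * T = -(T * Z) := eq_neg_of_add_eq_zero_right hZ
  rw [Matrix.mul_assoc, h, Matrix.mul_neg, ← Matrix.mul_assoc, Matrix.nonsing_inv_mul T hT, Matrix.one_mul, sub_neg_eq_add]

omit [DecidableEq ι] in
/-- `P` is additive: `P(Y − Y') = P(Y) − P(Y')`. [folklore] -/
theorem sub_conj_sub [DecidableEq ι] (Y Y' : Matrix ι ι R) :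
    (Y - Y') - T⁻¹ * ((Y - Y').map σ)ᵀ * T = (Y - T⁻¹ * (Y.map σ)ᵀ * T) - (Y' - T⁻¹ * (Y'.map σ)ᵀ * T) := by
  rw [Matrix.map_sub _ (map_sub σ), Matrix.transpose_sub, Matrix.mul_sub, Matrix.sub_mul]
  abel

end Projection

/-! ## §2 `N_Δ(L⁺)\N_Δ(𝔸)` is compact -/

/-- `σ = c ⊗ 1` fixes `⅟2 ∈ 𝔸_L`. [folklore] -/
theorem conjAdele_invOf_two :
    conjAdele (Fp L) L (IsCMField.complexConj L) (⅟ (2 : AdeleRing (𝓞 L) L)) = ⅟ (2 : AdeleRing (𝓞 L) L) := by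
  have h2 : (2 : AdeleRing (𝓞 L) L) * conjAdele (Fp L) L (IsCMField.complexConj L) (⅟ (2 : AdeleRing (𝓞 L) L)) = 1 := by
    have := congrArg (conjAdele (Fp L) L (IsCMField.complexConj L)) (mul_invOf_self (2 : AdeleRing (𝓞 L) L))
    rwa [map_mul, map_ofNat, map_one] at this
  rw [← invOf_eq_right_inv h2]

/-- **`N_Δ(L⁺)\N_Δ(𝔸)` IS COMPACT (cover form).**  For a non-degenerate doubled datum (`dV i, dW j ≠ 0`) there is a compact `K ⊆ N_Δ(𝔸)` such that
every `u ∈ N_Δ(𝔸)` has an `N_Δ(L⁺)`-translate `γ · u ∈ K` — the binder (C0) of the intertwining-operator convergence and of the constant-term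
volume. [cite: MoeglinWaldspurger1995, II.1.6 (proof of Prop. (i))] [cite: CasselsFrohlichANT1967, Ch. II §14] -/
theorem exists_isCompact_cover_unipDelta (hdV0 : ∀ i, dV i ≠ 0) (hdW0 : ∀ i, dW i ≠ 0) :
    ∃ K : Set (unipDelta L e dV hdV dW hdW), IsCompact K ∧
      ∀ u : unipDelta L e dV hdV dW hdW, ∃ γ : unipDeltaRat L e dV hdV dW hdW, γ • u ∈ K := by
  classical
  set σ := conjAdele (Fp L) L (IsCMField.complexConj L) with hσdef
  set f : L →+* AdeleRing (𝓞 L) L := algebraMap L (AdeleRing (𝓞 L) L) with hfdef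
  set TL : Matrix (Fin n) (Fin n) L := (gramR L e dV hdV dW hdW).map (algebraMap (Fp L) L) with hTLdef
  set T : Matrix (Fin n) (Fin n) (AdeleRing (𝓞 L) L) :=
    (gramR L e dV hdV dW hdW).map ((algebraMap L (AdeleRing (𝓞 L) L)).comp (algebraMap (Fp L) L)) with hTdef
  obtain ⟨hTLu, hTLc, hTLt, hTLmap⟩ := gramRL_facts L e dV hdV dW hdW hdV0 hdW0
  have hTu : IsUnit T.det := isUnit_det_gramRA L e dV hdV dW hdW hdV0 hdW0
  have hTσ : T.map σ = T := gramRA_map_conjAdele L e dV hdV dW hdW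
  have hTt : Tᵀ = T := gramRA_transpose L e dV hdV dW hdW
  have hσσ : ∀ x, σ (σ x) = x := conjAdele_conjAdele' L
  have hfc : ∀ x : L, f (((IsCMField.complexConj L : L ≃ₐ[Fp L] L) : L →+* L) x) = σ (f x) := fun x => algebraMap_conj (Fp L) L _ x
  -- the chart
  obtain ⟨φ, hφc, hφadd, hφmem, hφsurj, hφrat⟩ := exists_unipChart L e dV hdV dW hdW
  -- the projection `P` onto skew matrices, its rational model `P₀`
  let P : Matrix (Fin n) (Fin n) (AdeleRing (𝓞 L) L) → Matrix (Fin n) (Fin n) (AdeleRing (𝓞 L) L) := fun Y => Y - T⁻¹ * (Y.map σ)ᵀ * T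
  let P₀ : Matrix (Fin n) (Fin n) L → Matrix (Fin n) (Fin n) L :=
    fun Y => Y - TL⁻¹ * (Y.map ((IsCMField.complexConj L : L ≃ₐ[Fp L] L) : L →+* L))ᵀ * TL
  have hPskew : ∀ Y, T * P Y + ((P Y).map σ)ᵀ * T = 0 := fun Y => skew_sub_conj σ hTu hTσ hTt hσσ Y
  have hPc : Continuous P :=
    continuous_id.sub ((continuous_const.matrix_mul ((continuous_id.matrix_map (continuous_conjAdele (Fp L) L _)).matrix_transpose)).matrix_mul
      continuous_const)
  have hPrat : ∀ Y₀ : Matrix (Fin n) (Fin n) L, P (Y₀.map f) = (P₀ Y₀).map f := by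
    intro Y₀
    show Y₀.map f - T⁻¹ * ((Y₀.map f).map σ)ᵀ * T = (Y₀ - TL⁻¹ * (Y₀.map _)ᵀ * TL).map f
    rw [Matrix.map_sub _ (map_sub f), Matrix.map_mul, Matrix.map_mul, map_nonsing_inv_of_isUnit f hTLu, hTLmap, map_cstar f hfc]
  -- the skew matrices and the chart into `N_Δ(𝔸)`
  haveI : T2Space (AdeleRing (𝓞 L) L) := by
    haveI : T2Space (FiniteAdeleRing (𝓞 L) L) := inferInstanceAs <| T2Space
      (RestrictedProduct (fun v : HeightOneSpectrum (𝓞 L) => v.adicCompletion L)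
        (fun v => (v.adicCompletionIntegers L : Set (v.adicCompletion L))) Filter.cofinite)
    haveI : T2Space (InfiniteAdeleRing L) := inferInstanceAs <| T2Space ((w : InfinitePlace L) → w.Completion)
    exact inferInstanceAs <| T2Space (InfiniteAdeleRing L × FiniteAdeleRing (𝓞 L) L)
  let S : Set (Matrix (Fin n) (Fin n) (AdeleRing (𝓞 L) L)) := {X | T * X + (X.map σ)ᵀ * T = 0}
  have hSc : IsClosed S := isClosed_eq ((continuous_const.matrix_mul continuous_id).add
    (((continuous_id.matrix_map (continuous_conjAdele (Fp L) L _)).matrix_transpose).matrix_mul continuous_const)) continuous_const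
  let ψ : S → unipDelta L e dV hdV dW hdW := fun X => ⟨⟨φ X, (hφmem X X.2).choose⟩, (hφmem X X.2).choose_spec.1⟩
  have hψc : Continuous ψ := ((hφc.comp continuous_subtype_val).subtype_mk _).subtype_mk _
  -- the compact box and the compact set
  haveI : ∀ v : HeightOneSpectrum (𝓞 L), CompactSpace (v.adicCompletionIntegers L) := fun v => compactSpace_adicCompletionIntegers' L v
  obtain ⟨C, hC, hCcov⟩ := AdeleRing.exists_isCompact_forall_exists_sub_mem (K := L)
  let Box : Set (Matrix (Fin n) (Fin n) (AdeleRing (𝓞 L) L)) := Set.univ.pi fun _ => Set.univ.pi fun _ => C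
  have hBox : IsCompact Box := isCompact_univ_pi fun _ => isCompact_univ_pi fun _ => hC
  have hPBox : IsCompact (P '' Box) := hBox.image hPc
  have hPBoxS : P '' Box ⊆ S := by rintro _ ⟨Y, -, rfl⟩; exact hPskew Y
  have hpre : IsCompact ((Subtype.val : S → Matrix (Fin n) (Fin n) (AdeleRing (𝓞 L) L)) ⁻¹' (P '' Box)) :=
    (Topology.IsClosedEmbedding.subtypeVal hSc).isCompact_preimage hPBox
  refine ⟨ψ '' ((Subtype.val : S → Matrix (Fin n) (Fin n) (AdeleRing (𝓞 L) L)) ⁻¹' (P '' Box)), hpre.image hψc, fun u => ?_⟩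
  -- the cover: `u = n(X)`, `X' = ½ X = Y' + E`, `γ = n(−P Y')`
  set X : Matrix (Fin n) (Fin n) (AdeleRing (𝓞 L) L) := (blk L e dV hdV dW hdW (u : HA L e dV hdV dW hdW)).toBlocks₁₂ with hXdef
  have hXs : T * X + (X.map σ)ᵀ * T = 0 := skew_of_mem_unipDelta L e dV hdV dW hdW u.2
  set X' : Matrix (Fin n) (Fin n) (AdeleRing (𝓞 L) L) := (⅟ (2 : AdeleRing (𝓞 L) L)) • X with hX'def
  have hX's : T * X' + (X'.map σ)ᵀ * T = 0 := by
    rw [hX'def, Matrix.mul_smul, Matrix.map_smul _ _ (fun a => by rw [smul_eq_mul, smul_eq_mul, map_mul, conjAdele_invOf_two]),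
      Matrix.transpose_smul, Matrix.smul_mul, ← smul_add, hXs, smul_zero]
  have hPX' : P X' = X := by
    show X' - T⁻¹ * (X'.map σ)ᵀ * T = X
    rw [sub_conj_of_skew σ hTu hX's, hX'def, ← add_smul, invOf_two_add_invOf_two, one_smul]
  choose k hk using fun i j => hCcov (X' i j)
  let Y₀ : Matrix (Fin n) (Fin n) L := Matrix.of fun i j => k i j
  set E : Matrix (Fin n) (Fin n) (AdeleRing (𝓞 L) L) := X' - Y₀.map f with hEdef
  have hE : E ∈ Box := by
    refine Set.mem_univ_pi.2 fun i => Set.mem_univ_pi.2 fun j => ?_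
    show X' i j - f (k i j) ∈ C
    exact hk i j
  have hPE : P E = X - P (Y₀.map f) := by
    show (X' - Y₀.map f) - T⁻¹ * ((X' - Y₀.map f).map σ)ᵀ * T = X - (Y₀.map f - T⁻¹ * ((Y₀.map f).map σ)ᵀ * T)
    rw [sub_conj_sub σ, ← hPX']
  -- the rational element `γ = n(−P Y')`
  have hneg_skew : T * (-P (Y₀.map f)) + ((-P (Y₀.map f)).map σ)ᵀ * T = 0 := by
    rw [Matrix.mul_neg, Matrix.map_neg _ (map_neg σ), Matrix.transpose_neg, Matrix.neg_mul, ← neg_add, hPskew, neg_zero]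
  obtain ⟨hγHA, hγN, -⟩ := hφmem _ hneg_skew
  have hγrat : (⟨φ (-P (Y₀.map f)), hγHA⟩ : HA L e dV hdV dW hdW) ∈ ratH L e dV hdV dW hdW := by
    refine (mem_range_toAdelic_iff (Fp L) L (IsCMField.complexConj L) (hermD L e dV hdV dW hdW) _).2 ?_
    have h : -P (Y₀.map f) = (-(P₀ Y₀)).map f := by rw [hPrat, Matrix.map_neg _ (map_neg f)]
    rw [show ((⟨φ (-P (Y₀.map f)), hγHA⟩ : HA L e dV hdV dW hdW) : GL (Fin (n + n)) (AdeleRing (𝓞 L) L)) = φ (-P (Y₀.map f)) from rfl, h]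
    exact hφrat _
  let γ : unipDeltaRat L e dV hdV dW hdW := ⟨⟨⟨φ (-P (Y₀.map f)), hγHA⟩, hγN⟩, (mem_unipDeltaRat_iff L e dV hdV dW hdW _).2 hγrat⟩
  refine ⟨γ, ⟨⟨P E, hPskew E⟩, ⟨E, hE, rfl⟩, ?_⟩⟩
  -- `n(P E) = γ · u`
  refine Subtype.ext (Subtype.ext (Units.ext ?_))
  show ((φ (P E) : GL (Fin (n + n)) (AdeleRing (𝓞 L) L)) : Matrix (Fin (n + n)) (Fin (n + n)) (AdeleRing (𝓞 L) L)) =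
    (((((γ : unipDelta L e dV hdV dW hdW) * u : unipDelta L e dV hdV dW hdW) : HA L e dV hdV dW hdW) :
      GL (Fin (n + n)) (AdeleRing (𝓞 L) L)) : Matrix (Fin (n + n)) (Fin (n + n)) (AdeleRing (𝓞 L) L))
  rw [hPE, Subgroup.coe_mul, Subgroup.coe_mul, Units.val_mul, ← hφsurj (u : HA L e dV hdV dW hdW) u.2, ← hXdef, ← Units.val_mul, ← hφadd,
    neg_add_eq_sub]

end Summit.HodgeConjecture.HodgeConjecture.Cruxes.HLiu418.K2LiuUnipotentCocompact

end
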